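import Summits.QuantumFields.BalabanUV.Beta.D1BFx.CoframeWordShapes

/-!
# `BalabanUV.Beta.D1BFx.CoframeVertices` — road «BF-x» for binder row D1, slot (K), (II)-row (C2) «TB4-W CO-FRAME TABLE, m-UNIFORM MASS», FILE δ2
# «COFRAME VERTICES»: **THE PACKED GHOST CURRENT `gW w` AND THE DIAGONAL PAIR TABLE `d2W w w′` IN CLOSED FORM, AND THEIR MASS LETTERS** — rows and
# columns of `gW w` localised at the weight's centre with amplitude `8·C·e^{δ}` (`≍ n⁻⁴` at the road's weights), `TotMass (d2W w w′)
# (8·C·C′·Zl 4 (δ−θ)·e^{−θ|P−P′|₁})` (count half of (C2), OWNER RULING ρ-g19-1 AMENDED l.43347)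

HONEST DEPENDENCY (cell records, verbatim): «continuum YM on T⁴ ⇐ BetaPertH ∧ nine spine estimates (0/9 proved); BetaPertH ⇐ (D1) ∧ (D4) ∧
CAP+tail; G-an2-4 gates asym, D1 and NE2/3/4.»  HONEST FRAMING (cell contract, verbatim): «discharging `BetaPertH` makes Bałaban's UV stability
UNCONDITIONAL — a real constructive-QFT result; it is NOT the continuum limit and NOT the Clay problem.»  THIS MODULE DISCHARGES NOTHING of the
wall: [folklore] `ℓ¹` bookkeeping (`hasSum_ite_eq` against the nearest-neighbour indicators of `ghCur ∕ gh₂`, δ1's graph-supported kernels and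
`tsum_prodWeight_le`) over α1∕α2's predicates `RowMass ∕ ColMass ∕ TotMass`, on `Site 4 = ℤ⁴` with `Unit` fibre.  No definition,
no `def … : Prop`, nothing cited, 0 sorry.  0 root-level binders of row D1 discharged (hW ∕ hR-sockets ∕ hSX-socket ∕ D1Tel ∕ D1Rep = 0); (K) NOT closed;
(C1)(C2) NOT closed here; NOT D1, NOT `BetaPertH`, NOT continuum, NOT Clay.

ABSOLUTE RULE (cell charter, verbatim): «No internally-minted statement may enter as a cited fact. Every hypothesis is either kernel-proved in
this package or a verbatim quotation of a PUBLISHED theorem with page reference. The manuscript(s) under audit are NOT citable for their own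
disputed steps — they are the thing under adjudication; programme-internal (2001/route/tribunal) claims are never citable.»

WHY.  The vertices of every P4b word are `gW w = Σ_κ wsum (w κ) (ghCur κ)` (and `qW w = gW w∘(−Δ) + (−Δ)∘gW w`) and `d2W w w′ = Σ_κ wsum (w κ) (u ↦
w′ κ u·gh₂ κ u)`, with `w = colH G₀ n μ y` under the envelope `|w κ u| ≤ C·e^{−δ|u − n•y|₁}`, `C ≍ n⁻⁴`, `δ = κ′∕(4n)` («G0-COL-ENV»
`PackedColumnEnvelope.abs_colH_G₀_road_le`).  The sandwich of α2∕δ1b consumes exactly: localised column (and row) sums of the vertex and a plain row mass —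
supplied here for `gW w` — and the total mass of the two-weight vertex `d2W`.

CONTENT (all [folklore]; weights `w w′ : Fin 4 → Site 4 → ℝ` with `|w κ u| ≤ C·e^{−δ|u−P|₁}`, `|w′ κ u| ≤ C′·e^{−δ|u−P′|₁}`, `δ ≥ 0`).
* §1 `hasSum_weight_fwd ∕ bwd` (one index survives the superposition), **`gW_apply`** (`gW w (x,z) = Σ_κ ([x = z+e_κ]·w κ z − [z = x+e_κ]·w κ x)`),
  `trK_gW` (`= −gW w`), **`d2W_apply`** (`d2W w w′ (x,z) = −Σ_κ ([z = x+e_κ]·w κ x·w′ κ x + [x = z+e_κ]·w κ z·w′ κ z)`), `d2W_eq` (as a sum of graph kernels).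
* §2 `const_nonneg`, `weight_step ∕ weight_nostep`, **`cols_gW`** ∕ **`rows_gW`** (`Σ' ≤ 8·C·e^{δ}·e^{−δ|·−P|₁}`), `rowFn_gW_swap`, **`masses_gW`**
  (`RowMass ∕ ColMass (gW w) 0 (8·C·e^{δ})`).
* §3 `totMass_finset_sum`, `abs_prodWeight_le`, **`totMass_d2W`** (`0 ≤ θ < δ` ⟹ `TotMass (d2W w w′) (8·((C·C′)·Zl 4 (δ−θ)·e^{−θ|P−P′|₁}))`).
NOT HERE: the sixteen words and `cofPairInf` at the road's weights on `n = L^k` (δ3).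
Unit `b2b-balaban-gan24-formalise-leaf-05` (gen 54), G-an2-4 swarm leaf prover 05, road «BF-x» (C1)(C2) count owner; INTENT «COFRAME SHAPES» (journal).
-/


noncomputable section

namespace Summit.QuantumFields.BalabanUV.Beta.D1BFx.CoframeVertices

open scoped BigOperators
open Finset
open Literature.MathematicalPhysics.QuantumFieldTheory.Balaban1983to89
open Literature.MathematicalPhysics.QuantumFieldTheory.Balaban1983to89.Beta
open B12Sec2to5 (l1 l1_nonneg)
open ExpKernelCalculus (Site MKer comp Zl Zl_pos l1_sub_triangle l1_sub_symm summable_exp_shift' tsum_exp_shift')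
open AffineAveraging (unitVec)
open OneStepResolventKernel (wsum)
open Summit.QuantumFields.BalabanUV.Beta.TameKernelCalculus (trK trK_trK)
open Summit.QuantumFields.BalabanUV.Beta.D1BFx.GhostStencil (ghCur ghCur_apply ghCur_antisymm l1_unitVec l1_zero)
open Summit.QuantumFields.BalabanUV.Beta.D1BFx.TorusGhostPairStencils (gh₂ gh₂_apply)
open Summit.QuantumFields.BalabanUV.Beta.D1BFx.PackedCoframeSiteWords (gW d2W)
open Summit.QuantumFields.BalabanUV.Beta.D1BFx.KernelMassCalculus
open Summit.QuantumFields.BalabanUV.Beta.D1BFx.KernelMassTotal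
open Summit.QuantumFields.BalabanUV.Beta.D1BFx.CoframeWordShapes

variable (w w' : Fin 4 → Site 4 → ℝ)

/-! ## §1 Closed forms -/

/-- [folklore] One packed current against one weight: only `u = z` survives. -/
theorem hasSum_weight_fwd (κ : Fin 4) (x z : Site 4) (c : Site 4 → ℝ) :
    HasSum (fun u => c u * (if x = u + unitVec κ ∧ z = u then (1 : ℝ) else 0)) (if x = z + unitVec κ then c z else 0) := by
  have e : (fun u => c u * (if x = u + unitVec κ ∧ z = u then (1 : ℝ) else 0))
      = fun u => if u = z then (if x = z + unitVec κ then c z else 0) else 0 := by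
    funext u
    by_cases hu : u = z
    · subst hu
      by_cases hx : x = u + unitVec κ
      · rw [if_pos ⟨hx, rfl⟩, if_pos rfl, if_pos hx, mul_one]
      · rw [if_neg (fun h => hx h.1), if_pos rfl, if_neg hx, mul_zero]
    · rw [if_neg (fun h => hu h.2.symm), mul_zero, if_neg hu]
  rw [e]; exact hasSum_ite_eq z _

/-- [folklore] … and the reversed hop: only `u = x` survives. -/
theorem hasSum_weight_bwd (κ : Fin 4) (x z : Site 4) (c : Site 4 → ℝ) :
    HasSum (fun u => c u * (if x = u ∧ z = u + unitVec κ then (1 : ℝ) else 0)) (if z = x + unitVec κ then c x else 0) := by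
  have e : (fun u => c u * (if x = u ∧ z = u + unitVec κ then (1 : ℝ) else 0))
      = fun u => if u = x then (if z = x + unitVec κ then c x else 0) else 0 := by
    funext u
    by_cases hu : u = x
    · subst hu
      by_cases hz : z = u + unitVec κ
      · rw [if_pos ⟨rfl, hz⟩, if_pos rfl, if_pos hz, mul_one]
      · rw [if_neg (fun h => hz h.2), if_pos rfl, if_neg hz, mul_zero]
    · rw [if_neg (fun h => hu h.1.symm), mul_zero, if_neg hu]
  rw [e]; exact hasSum_ite_eq x _

/-- [folklore] **THE PACKED GHOST CURRENT IN CLOSED FORM**: `gW w (x,z) = Σ_κ ([x = z+e_κ]·w κ z − [z = x+e_κ]·w κ x)` (a nearest-neighbour hopping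
weighted by the bond's weight, antisymmetric). -/
theorem gW_apply (x z : Site 4) :
    gW w x z () () = ∑ κ : Fin 4, ((if x = z + unitVec κ then w κ z else 0) - (if z = x + unitVec κ then w κ x else 0)) := by
  unfold gW OneStepResolventKernel.wsum
  refine Finset.sum_congr rfl fun κ _ => ?_
  have e3 : (fun u => w κ u * ghCur κ u x z () ())
      = fun u => w κ u * (if x = u + unitVec κ ∧ z = u then (1 : ℝ) else 0) - w κ u * (if x = u ∧ z = u + unitVec κ then (1 : ℝ) else 0) := by
    funext u; rw [ghCur_apply, mul_sub]
  rw [e3, ((hasSum_weight_fwd κ x z (w κ)).sub (hasSum_weight_bwd κ x z (w κ))).tsum_eq]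

/-- [folklore] `gW w` is antisymmetric: `trK (gW w) = −gW w`. -/
theorem trK_gW : trK (gW w) = -gW w := by
  funext x z a b
  show (∑ κ : Fin 4, ∑' u, w κ u * ghCur κ u z x b a) = -(∑ κ : Fin 4, ∑' u, w κ u * ghCur κ u x z a b)
  rw [← Finset.sum_neg_distrib]
  refine Finset.sum_congr rfl fun κ _ => ?_
  rw [← tsum_neg]
  exact tsum_congr fun u => by rw [ghCur_antisymm]; ring

/-- [folklore] **THE DIAGONAL PAIR TABLE IN CLOSED FORM**: `d2W w w′ (x,z) = −Σ_κ ([z = x+e_κ]·w κ x·w′ κ x + [x = z+e_κ]·w κ z·w′ κ z)`. -/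
theorem d2W_apply (x z : Site 4) :
    d2W w w' x z () () = -∑ κ : Fin 4, ((if z = x + unitVec κ then w κ x * w' κ x else 0) + (if x = z + unitVec κ then w κ z * w' κ z else 0)) := by
  unfold d2W OneStepResolventKernel.wsum
  rw [← Finset.sum_neg_distrib]
  refine Finset.sum_congr rfl fun κ _ => ?_
  have e3 : (fun u => w κ u * (w' κ u * gh₂ κ u x z () ()))
      = fun u => -((w κ u * w' κ u) * (if x = u ∧ z = u + unitVec κ then (1 : ℝ) else 0)
          + (w κ u * w' κ u) * (if x = u + unitVec κ ∧ z = u then (1 : ℝ) else 0)) := by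
    funext u; rw [gh₂_apply]; ring
  rw [e3, tsum_neg, ((hasSum_weight_bwd κ x z (fun u => w κ u * w' κ u)).add (hasSum_weight_fwd κ x z (fun u => w κ u * w' κ u))).tsum_eq]

/-- [folklore] `d2W w w′` as a finite sum of graph-supported kernels. -/
theorem d2W_eq : d2W w w' = -∑ κ : Fin 4, ((fun x z (_ _ : Unit) => if z = x + unitVec κ then w κ x * w' κ x else (0 : ℝ))
    + (fun x z (_ _ : Unit) => if x = z + unitVec κ then w κ z * w' κ z else (0 : ℝ))) := by
  funext x z a b
  obtain ⟨⟩ := a; obtain ⟨⟩ := b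
  rw [d2W_apply]
  simp only [Pi.neg_apply, Finset.sum_apply, Pi.add_apply]

/-! ## §2 The mass letters of `gW w` -/

variable {w w'} {C C' δ θ : ℝ} {P P' : Site 4}

/-- [folklore] The envelope constant is nonnegative. -/
theorem const_nonneg (hw : ∀ κ u, |w κ u| ≤ C * Real.exp (-δ * l1 (u - P))) : 0 ≤ C := by
  have h := hw 0 P
  rw [sub_self, l1_zero, mul_zero, Real.exp_zero, mul_one] at h
  exact (abs_nonneg _).trans h

/-- [folklore] One step costs `e^{δ}`: `|w κ (y − e_κ)| ≤ C·e^{δ}·e^{−δ|y−P|₁}` (`δ ≥ 0`). -/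
theorem weight_step (hw : ∀ κ u, |w κ u| ≤ C * Real.exp (-δ * l1 (u - P))) (hδ : 0 ≤ δ) (κ : Fin 4) (y : Site 4) :
    |w κ (y - unitVec κ)| ≤ C * Real.exp δ * Real.exp (-δ * l1 (y - P)) := by
  refine (hw κ _).trans ?_
  rw [mul_assoc, ← Real.exp_add]
  refine mul_le_mul_of_nonneg_left (Real.exp_le_exp.2 ?_) (const_nonneg hw)
  have := l1_sub_triangle y (y - unitVec κ) P
  have e : l1 (y - (y - unitVec κ)) = 1 := by rw [sub_sub_cancel, l1_unitVec]
  nlinarith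

/-- [folklore] No step also fits under `C·e^{δ}·e^{−δ|y−P|₁}` (`δ ≥ 0`). -/
theorem weight_nostep (hw : ∀ κ u, |w κ u| ≤ C * Real.exp (-δ * l1 (u - P))) (hδ : 0 ≤ δ) (κ : Fin 4) (y : Site 4) :
    |w κ y| ≤ C * Real.exp δ * Real.exp (-δ * l1 (y - P)) := by
  refine (hw κ y).trans ?_
  rw [mul_assoc]
  refine mul_le_mul_of_nonneg_left ?_ (const_nonneg hw)
  have h1 : (1 : ℝ) ≤ Real.exp δ := by linarith [Real.add_one_le_exp δ]
  nlinarith [Real.exp_pos (-δ * l1 (y - P))]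

/-- [folklore] **THE COLUMNS OF `gW w` ARE LOCALISED AT THE WEIGHT's CENTRE**: `Σ'_x |gW w (x,y)| ≤ 8·C·e^{δ}·e^{−δ|y−P|₁}` (two entries per bond
direction: `w κ y` at `x = y+e_κ` and `w κ (y−e_κ)` at `x = y−e_κ`). -/
theorem cols_gW (hw : ∀ κ u, |w κ u| ≤ C * Real.exp (-δ * l1 (u - P))) (hδ : 0 ≤ δ) (y : Site 4) :
    (Summable fun x => rowFn (gW w) 0 x y) ∧ ∑' x, rowFn (gW w) 0 x y ≤ 8 * C * Real.exp δ * Real.exp (-δ * l1 (y - P)) := by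
  set F : Site 4 → ℝ := fun x => ∑ κ : Fin 4,
    ((if x = y + unitVec κ then |w κ y| else 0) + (if x = y - unitVec κ then |w κ (y - unitVec κ)| else 0)) with hF
  have hFsum : HasSum F (∑ κ : Fin 4, (|w κ y| + |w κ (y - unitVec κ)|)) :=
    hasSum_sum fun κ _ => (hasSum_ite_eq (y + unitVec κ) |w κ y|).add (hasSum_ite_eq (y - unitVec κ) |w κ (y - unitVec κ)|)
  have hle : ∀ x, rowFn (gW w) 0 x y ≤ F x := by
    intro x
    rw [rowFn_zero, fib_unit, gW_apply, hF]
    refine (Finset.abs_sum_le_sum_abs _ _).trans (Finset.sum_le_sum fun κ _ => ?_)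
    refine (abs_sub _ _).trans (add_le_add ?_ ?_)
    · by_cases h : x = y + unitVec κ
      · rw [if_pos h, if_pos h]
      · rw [if_neg h, if_neg h, abs_zero]
    · by_cases h : y = x + unitVec κ
      · have hx : x = y - unitVec κ := by rw [h, add_sub_cancel_right]
        rw [if_pos h, if_pos hx, ← hx]
      · have hx : ¬ x = y - unitVec κ := fun hx => h (by rw [hx, sub_add_cancel])
        rw [if_neg h, if_neg hx, abs_zero]
  have hbound : ∑ κ : Fin 4, (|w κ y| + |w κ (y - unitVec κ)|) ≤ 8 * C * Real.exp δ * Real.exp (-δ * l1 (y - P)) := by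
    calc ∑ κ : Fin 4, (|w κ y| + |w κ (y - unitVec κ)|)
        ≤ ∑ _κ : Fin 4, (C * Real.exp δ * Real.exp (-δ * l1 (y - P)) + C * Real.exp δ * Real.exp (-δ * l1 (y - P))) :=
          Finset.sum_le_sum fun κ _ => add_le_add (weight_nostep hw hδ κ y) (weight_step hw hδ κ y)
      _ = 8 * C * Real.exp δ * Real.exp (-δ * l1 (y - P)) := by
          simp only [Finset.sum_const, Finset.card_univ, Fintype.card_fin, nsmul_eq_mul]; ring
  have hs : Summable fun x => rowFn (gW w) 0 x y := hFsum.summable.of_nonneg_of_le (fun x => rowFn_nonneg _ _ _ _) hle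
  refine ⟨hs, ?_⟩
  calc ∑' x, rowFn (gW w) 0 x y ≤ ∑' x, F x := Summable.tsum_le_tsum hle hs hFsum.summable
    _ = ∑ κ : Fin 4, (|w κ y| + |w κ (y - unitVec κ)|) := hFsum.tsum_eq
    _ ≤ _ := hbound

/-- [folklore] The row profile of `gW w` is the column profile (antisymmetry). -/
theorem rowFn_gW_swap (x y : Site 4) : rowFn (gW w) 0 x y = rowFn (gW w) 0 y x := by
  rw [← rowFn_trK (gW w) 0 y x, trK_gW]
  simp only [rowFn, Pi.neg_apply, abs_neg]

/-- [folklore] **THE ROWS OF `gW w` ARE LOCALISED AT THE WEIGHT's CENTRE**: `Σ'_y |gW w (x,y)| ≤ 8·C·e^{δ}·e^{−δ|x−P|₁}`. -/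
theorem rows_gW (hw : ∀ κ u, |w κ u| ≤ C * Real.exp (-δ * l1 (u - P))) (hδ : 0 ≤ δ) (x : Site 4) :
    Summable (rowFn (gW w) 0 x) ∧ ∑' y, rowFn (gW w) 0 x y ≤ 8 * C * Real.exp δ * Real.exp (-δ * l1 (x - P)) := by
  have e : rowFn (gW w) 0 x = fun y => rowFn (gW w) 0 y x := by funext y; exact rowFn_gW_swap x y
  rw [e]; exact cols_gW hw hδ x

/-- [folklore] **ROW AND COLUMN MASS OF `gW w`**: `8·C·e^{δ}` (`δ ≥ 0`). -/
theorem masses_gW (hw : ∀ κ u, |w κ u| ≤ C * Real.exp (-δ * l1 (u - P))) (hδ : 0 ≤ δ) :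
    RowMass (gW w) 0 (8 * C * Real.exp δ) ∧ ColMass (gW w) 0 (8 * C * Real.exp δ) := by
  have hC8 : 0 ≤ 8 * C * Real.exp δ := by have := const_nonneg hw; positivity
  have hE : ∀ v : Site 4, 8 * C * Real.exp δ * Real.exp (-δ * l1 (v - P)) ≤ 8 * C * Real.exp δ := fun v => by
    refine mul_le_of_le_one_right hC8 ?_
    rw [Real.exp_le_one_iff]; nlinarith [l1_nonneg (v - P)]
  exact ⟨fun x => ⟨(rows_gW hw hδ x).1, (rows_gW hw hδ x).2.trans (hE x)⟩, fun y => ⟨(cols_gW hw hδ y).1, (cols_gW hw hδ y).2.trans (hE y)⟩⟩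

/-! ## §3 The total mass of the diagonal pair table -/

/-- [folklore] A finite sum of kernels: total masses add. -/
theorem totMass_finset_sum {ι : Type*} (s : Finset ι) {K : ι → MKer 4 Unit} {M : ι → ℝ} (h : ∀ i ∈ s, TotMass (K i) (M i)) :
    TotMass (∑ i ∈ s, K i) (∑ i ∈ s, M i) := by
  classical
  induction s using Finset.induction_on with
  | empty =>
      rw [Finset.sum_empty, Finset.sum_empty]
      refine ⟨?_, ?_⟩
      · simp
      · simp
  | insert a s ha ih =>
      rw [Finset.sum_insert ha, Finset.sum_insert ha]
      exact totMass_add (h a (Finset.mem_insert_self a s)) (ih fun i hi => h i (Finset.mem_insert_of_mem hi))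

/-- [folklore] The product weight of the diagonal table: `|w κ u·w′ κ u| ≤ C·C′·e^{−δ|u−P|₁}·e^{−δ|u−P′|₁}`. -/
theorem abs_prodWeight_le (hw : ∀ κ u, |w κ u| ≤ C * Real.exp (-δ * l1 (u - P))) (hw' : ∀ κ u, |w' κ u| ≤ C' * Real.exp (-δ * l1 (u - P')))
    (κ : Fin 4) (u : Site 4) :
    |w κ u * w' κ u| ≤ C * C' * Real.exp (-δ * l1 (u - P)) * Real.exp (-δ * l1 (u - P')) := by
  rw [abs_mul, show C * C' * Real.exp (-δ * l1 (u - P)) * Real.exp (-δ * l1 (u - P'))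
    = (C * Real.exp (-δ * l1 (u - P))) * (C' * Real.exp (-δ * l1 (u - P'))) by ring]
  exact mul_le_mul (hw κ u) (hw' κ u) (abs_nonneg _) ((abs_nonneg _).trans (hw κ u))

/-- [folklore] **THE TOTAL MASS OF THE DIAGONAL PAIR TABLE**: weights localised at `P`, `P′` with rate `δ`, `0 ≤ θ < δ` ⟹
`TotMass (d2W w w′) (8·(C·C′)·Zl 4 (δ−θ)·e^{−θ|P−P′|₁})` — order `n⁻⁸·n⁴` at the road's weights, with the separation factor. -/
theorem totMass_d2W (hw : ∀ κ u, |w κ u| ≤ C * Real.exp (-δ * l1 (u - P))) (hw' : ∀ κ u, |w' κ u| ≤ C' * Real.exp (-δ * l1 (u - P')))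
    (hθ : 0 ≤ θ) (hθδ : θ < δ) :
    TotMass (d2W w w') (8 * ((C * C') * Zl 4 (δ - θ) * Real.exp (-θ * l1 (P - P')))) := by
  have hS : ∀ κ : Fin 4, (Summable fun u => |w κ u * w' κ u|) ∧
      ∑' u, |w κ u * w' κ u| ≤ (C * C') * Zl 4 (δ - θ) * Real.exp (-θ * l1 (P - P')) := fun κ =>
    tsum_prodWeight_le (fun u => abs_prodWeight_le hw hw' κ u) hθ hθδ
  have hκ : ∀ κ ∈ (Finset.univ : Finset (Fin 4)), TotMass
      ((fun x z (_ _ : Unit) => if z = x + unitVec κ then w κ x * w' κ x else (0 : ℝ))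
        + (fun x z (_ _ : Unit) => if x = z + unitVec κ then w κ z * w' κ z else (0 : ℝ)))
      ((C * C') * Zl 4 (δ - θ) * Real.exp (-θ * l1 (P - P')) + (C * C') * Zl 4 (δ - θ) * Real.exp (-θ * l1 (P - P'))) := by
    intro κ _
    exact totMass_add (totMass_mono (totMass_rowGraph (fun x => x + unitVec κ) (hS κ).1) (hS κ).2)
      (totMass_mono (totMass_colGraph (fun z => z + unitVec κ) (hS κ).1) (hS κ).2)
  rw [d2W_eq]
  refine totMass_mono (totMass_neg (totMass_finset_sum _ hκ)) (le_of_eq ?_)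
  simp only [Finset.sum_const, Finset.card_univ, Fintype.card_fin, nsmul_eq_mul]; ring

end Summit.QuantumFields.BalabanUV.Beta.D1BFx.CoframeVertices

end
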